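import Summits.BirchSwinnertonDyer.BirchSwinnertonDyer.Theorems.CumulativeHeegnerLeopoldtCumulativeHeegnerInclusionAtThreeStubResidualSelmerFiniteDevissageNamed
import Summits.BirchSwinnertonDyer.BirchSwinnertonDyer.Theorems.UniversalToricDescentResidualSelmerFinite
import Summits.BirchSwinnertonDyer.BirchSwinnertonDyer.Theorems.CumulativeHeegnerLeopoldtCumulativeHeegnerInclusionAtThreeStubResidualSelmerFiniteDevissageCurve
import Summits.BirchSwinnertonDyer.BirchSwinnertonDyer.Theorems.CumulativeHeegnerLeopoldtCumulativeHeegnerInclusionAtThreeResidualDevissage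
import Literature.NumberTheory.EllipticCurves.DivisionFieldRamificationDividesProofs
import HarnessLib

/-!
# The residual dévissage WITHOUT the non-anomalous clause: `R_𝔭^Σ(K_∞, A)` and `R_𝔭^Σ(K_∞, C)` finite ⟹
# `R_𝔭^Σ(K_∞, B)` finite along `0 → A → B → C → 0` with `C` FINITE and `𝔭` finitely decomposed in `K_∞`
# (cell `bsd-eis`, seat `bsd-line-x2-p2` gen 4, D-0154 KEY row 5; crux 4 `BSDpOnCellC` line b1, the SPLIT half of
# `stub_lemma511`; companions p626493 and chl-k1's `…StubResidualSelmerFiniteDevissageNamed`)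

HONEST FRAMING (cell `bsd-eis`, run/shared/lean/pub/bsd-eis/): pure Galois-cohomology bookkeeping on constructed
objects (no definition, no named fact, no `sorry`, no `Theses` import); nothing about any curve is asserted;
nothing booked; no label or count moves; BSD and the main conjectures are proved for NO curve. Helper
`--supports stmt-BirchSwinnertonDyer-19034`; closes no registered stub.

## Why

The finiteness half of Castella–Grossi–Lee–Skinner 2022 Prop. 17 in the tree
(`CumulativeHeegnerInclusionAtThreeStubB1DevissageNamed.finite_datumStrictSelmer_of_devissage`, chl-k1-w2) bounds
the residual group `R_𝔭^Σ(L, B) = GreenbergVatsal2000.datumStrictSelmer H B p (AcSelmer.bdpData B p 𝔭) Σ` by those of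
`A` and `C` under TWO local injectivity hypotheses on `j_* : H¹(·, A) → H¹(·, B)`: (U) at the inertia groups of the
good places and (S) at `H ⊓ D_𝔭` — (S) holds when `C^{H ⊓ D_𝔭} = 0`, the NON-ANOMALOUS clause `ψ|_{G_{K_{∞,𝔭}}} ≠ 1`.
At a SPLIT multiplicative Eisenstein prime with the rational line `Φ` equal to the Tate `μ`-line, `E[p]/Φ` is
locally TRIVIAL (`X2.TateLineDecomposition.fix_or_quot_of_split`) and (S) FAILS. This file removes (S) when `C` is
finite and `𝔭` is finitely decomposed in `L = K_∞` (`H = ker κ`, `D_𝔭 ⊄ ker κ` — Brink for the anticyclotomic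
tower): the kernel of `j_*` on `H¹(H ⊓ D_𝔭, A)` injects into `C` (connecting map), hence is FINITE; the "signature"
of a class `x ∈ j_*⁻¹(R(B))`, i.e. the restrictions to `H ⊓ D_𝔭` of its `p^c` conjugates by representatives of
`Γ_K / ⟨H, D_𝔭⟩` (tree `UniversalToricDescentResidualSelmerFinite.forall_resOfLe_conjH1_eq_zero_of_reps`), takes
values in that finite kernel, and two classes with the same signature differ by an element of `R(A)`. So
`j_*⁻¹(R(B))` is finite as soon as `R(A)` is, with no condition at `𝔭` on `C`:

* §1 `finite_ker_resH1Hom_id_of_finite` — for any topological group `G` and exact `0 → A —j→ B —q→ C` of discrete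
  `G`-modules with `C` finite, `{y ∈ H¹(G, A) : j_* y = 0}` is finite (it injects into `C` by `[φ] ↦ q b` where
  `j ∘ φ = ∂b`; Serre I.§2.2, the connecting homomorphism).
* §2 **`finite_datumStrictSelmer_of_devissage_of_finite`** — `H = ker κ` for a `ℤ_p`-extension `κ`, `D_𝔭 ⊄ ker κ`,
  (U) at the good places outside `Σ`, `C` finite: `R(A)` finite ∧ `R(C)` finite ⟹ `R(B)` finite; and
  `finite_datumStrictSelmer_of_devissage_of_finite_of_unramified` with (U) discharged by «`I_v` acts trivially on
  `B`» (`resH1Hom_id_injective_of_smul_eq`).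
* §3 **`finite_selmerAc_pTorsion_of_line_devissage_of_finite`** — the elliptic-curve assembly WITHOUT the fixed-vector
  hypothesis: `E = W/K`, `κ` any `ℤ_p`-extension, `𝔭 ∋ p` with `D_𝔭 ⊄ ker κ`, `Σ ⊇` the bad places prime to `p`,
  `Φ ≤ E[p]` a `Γ_K`-stable subgroup: `R(Φ)` finite ∧ `R(E[p]/Φ)` finite ⟹ `Sel_𝔭^Σ(K_∞, E[p^∞])[p]` finite
  (the tree's `…ResidualDevissage.finite_selmerAc_pTorsion_of_line_devissage` minus `hfix`).

CONSEQUENCE for crux 4 (module docstring only; nothing asserted): with §3 the SPLIT half of Keller–Yin Lemma 5.1.1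
reduces to the finiteness of the residual Selmer groups of the two characters `{1̃, ω̃}` of `E[p]^{ss}` over the
anticyclotomic tower — Keller–Yin arXiv:2402.12781v2 Prop. 1.2.5 ("Moreover, `H¹_{𝓕_nr}^S(K, M_θ[p])` is finite",
arbitrary `θ`; preprint) — exactly as the NON-SPLIT half reduced to CGLS22 Prop. 14 (p626493).

References: [CastellaGrossiLeeSkinner2022] Prop. 17 (arXiv:2008.02571 §1.4); [SerreGaloisCohomology1997] I.§2.2
(Prop. 2), I.§5; [GreenbergLNM1716] §1 p. 60, §3; [LimSujatha2018] §3 Prop. 3.2; [Brink2007] Cor. 1;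
[KellerYin2024] Lemma 1.2.4, Prop. 1.2.5, Thm. 1.4.1 (arXiv:2402.12781v2 §1.2–1.4); cell p609974, p613183, p626493.
-/

set_option autoImplicit false
set_option linter.dupNamespace false -- the summit namespace `…BirchSwinnertonDyer.BirchSwinnertonDyer.Theorems` (Sub = Summit, D-0017) trips it

noncomputable section

open scoped Classical

universe u

namespace Summit.BirchSwinnertonDyer.BirchSwinnertonDyer.Theorems.ResidualDevissageFiniteKernel

open Literature.NumberTheory.EllipticCurves Literature.NumberTheory.EllipticCurves.GreenbergSelmer
  Literature.NumberTheory.EllipticCurves.GreenbergVatsal2000 Literature.NumberTheory.GaloisRepresentations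
  Literature.NumberTheory.EllipticCurves.FineSelmerCoefficientMap
  NumberField IsDedekindDomain Field WeierstrassCurve
  Summit.BirchSwinnertonDyer.Rank1Residual.X11b Summit.BirchSwinnertonDyer.Rank1Residual.X11b.AcSelmer
  Summit.BirchSwinnertonDyer.Rank1Residual.X2.ResidualDevissageModules
  Summit.BirchSwinnertonDyer.BirchSwinnertonDyer.Theorems.UniversalToricDescentResidualSelmer
  Summit.BirchSwinnertonDyer.BirchSwinnertonDyer.Theorems.UniversalToricDescentResidualSelmerFinite
  Summit.BirchSwinnertonDyer.BirchSwinnertonDyer.Theorems.CumulativeHeegnerInclusionAtThreeStubB1Devissage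
  Summit.BirchSwinnertonDyer.BirchSwinnertonDyer.Theorems.CumulativeHeegnerInclusionAtThreeStubB1DevissageNamed
  Summit.BirchSwinnertonDyer.BirchSwinnertonDyer.Theorems.CumulativeHeegnerInclusionAtThreeResidualDevissage

/-! ### §1 The kernel of `j_* : H¹(G, A) → H¹(G, B)` is finite when `C` is finite -/

section Kernel

variable {G : Type u} [Group G] [TopologicalSpace G] [IsTopologicalGroup G]
variable {A : Type u} [AddCommGroup A] [DistribMulAction G A] [TopologicalSpace A] [DiscreteTopology A]
variable {B : Type u} [AddCommGroup B] [DistribMulAction G B] [TopologicalSpace B] [DiscreteTopology B]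
variable {C : Type u} [AddCommGroup C]

/-- **`ker(j_* : H¹(G, A) → H¹(G, B))` is finite when `C` is finite**, for an exact `0 → A —j→ B —q→ C`
(`j` injective, `ker q ⊆ im j`; no surjectivity and no `G`-equivariance of `q` needed): a class
`[φ]` with `j ∘ φ = ∂b` is sent to `q b ∈ C`, and `q b = q b'` forces `b − b' = j a₀`, `φ − φ' = ∂a₀`,
`[φ] = [φ']`. (The kernel is the image of `C^G` under the connecting homomorphism.)
[cite: SerreGaloisCohomology1997, I.§2.2 (Prop. 2, exact sequence of cohomology) and I.§5.4] -/
theorem finite_ker_resH1Hom_id_of_finite [Finite C] (j : A →+ B)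
    (hj : ∀ (g : G) (a : A), j (ContinuousMonoidHom.id G g • a) = g • j a) (hinj : Function.Injective j)
    (q : B →+ C) (hexact : ∀ b : B, q b = 0 → ∃ a : A, j a = b) :
    Set.Finite {y : discreteH1 G A | resH1Hom (ContinuousMonoidHom.id G) j hj y = 0} := by
  have hj' : ∀ (g : G) (a : A), j (g • a) = g • j a := hj
  -- representatives: a cocycle `φ` of `y` and `b` with `j ∘ φ = ∂b`
  have hrep : ∀ y : {y : discreteH1 G A // resH1Hom (ContinuousMonoidHom.id G) j hj y = 0},
      ∃ φ : contOneCocycles (discreteTopRep G A), ∃ b : B,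
        oneCocycleClass _ φ = y.1 ∧ ∀ g : G, j (φ.1 g) = g • b - b := by
    intro y
    obtain ⟨φ, hφ⟩ := oneCocycleClass_surjective _ y.1
    have h0 := y.2
    rw [← hφ, resH1Hom_id_oneCocycleClass, oneCocycleClass_eq_zero_iff] at h0
    obtain ⟨b, hb⟩ := h0
    exact ⟨φ, b, hφ, fun g ↦ hb g⟩
  choose φ b hφ hb using hrep
  -- `y ↦ q (b y)` is injective
  have hf : Function.Injective fun y : {y : discreteH1 G A //
      resH1Hom (ContinuousMonoidHom.id G) j hj y = 0} ↦ q (b y) := by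
    intro y y' h
    have hq0 : q (b y - b y') = 0 := by
      have h' : q (b y) = q (b y') := h
      rw [map_sub, h', sub_self]
    obtain ⟨a₀, ha₀⟩ := hexact _ hq0
    apply Subtype.ext
    rw [← hφ y, ← hφ y', ← sub_eq_zero, ← oneCocycleClass_sub, oneCocycleClass_eq_zero_iff]
    refine ⟨a₀, fun g ↦ hinj ?_⟩
    change j (((φ y) - (φ y')).1 g) = j (g • a₀ - a₀)
    rw [Submodule.coe_sub, ContinuousMap.sub_apply, map_sub, hb, hb, map_sub, hj', ha₀, smul_sub]
    abel
  exact Set.finite_coe_iff.mp (Finite.of_injective _ hf)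

end Kernel

/-! ### §2 The dévissage without hypothesis (S), for `C` finite and `𝔭` finitely decomposed -/

section Residual

variable {K : Type} [Field K] [NumberField K] {p : ℕ} [Fact p.Prime] (κ : ZpExtension K p)
  (𝔭 : HeightOneSpectrum (𝓞 K)) (S₀ : Set (HeightOneSpectrum (𝓞 K)))

variable {A : Type} [AddCommGroup A] [DistribMulAction (absoluteGaloisGroup K) A] [TopologicalSpace A]
  [DiscreteTopology A]
variable {B : Type} [AddCommGroup B] [DistribMulAction (absoluteGaloisGroup K) B] [TopologicalSpace B]
  [DiscreteTopology B]
variable {C : Type} [AddCommGroup C] [DistribMulAction (absoluteGaloisGroup K) C] [TopologicalSpace C]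
  [DiscreteTopology C]

/-- **`j_*⁻¹(R_𝔭^Σ(K_∞, B))` is finite when `R_𝔭^Σ(K_∞, A)` is, WITHOUT hypothesis (S).** Setting: `H = ker κ`,
`𝔭 ∋ p` with `D_𝔭 ⊄ ker κ` (finitely decomposed), `j : A → B` `Γ_K`-equivariant with `j_*` injective on the inertia
cohomology at the good places outside `Σ` (U), and the kernel `T` of `j_*` on `H¹(H ⊓ D_𝔭, ·)` FINITE.
Proof (the signature argument of `finite_selmerAc_pTorsion_of_finite_residualSelmer`): with representatives
`τ i`, `κ(τ i) = i`, `i < p^c` (`forall_resOfLe_conjH1_eq_zero_of_reps`), the map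
`Ψ x = (res_{H ⊓ D_𝔭} conj_{τ i} x)_{i < p^c}` sends `j_*⁻¹(R(B))` into `T^{p^c}` (naturality of `j_*`), and its
kernel there lies in `R(A)` ((U) for the unramified conditions, the representatives for the strict ones).
[cite: GreenbergLNM1716, §3 (Lemmas 3.1–3.3)] [cite: LimSujatha2018, §3 (proof of Prop. 3.2)]
[cite: CastellaGrossiLeeSkinner2022, Prop. 17 (arXiv:2008.02571 §1.4)] -/
theorem finite_preimage_datumStrictSelmer_of_finite_ker (h𝔭 : ((p : ℕ) : 𝓞 K) ∈ 𝔭.asIdeal)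
    (h𝔭dec : ¬ (decomp 𝔭 ≤ κ.kerSubgroup))
    (j : A →+ B) (hj' : ∀ (σ : absoluteGaloisGroup K) (a : A), j (σ • a) = σ • j a)
    (hU : ∀ v : HeightOneSpectrum (𝓞 K), v ∉ S₀ → ((p : ℕ) : 𝓞 K) ∉ v.asIdeal →
      Function.Injective
        (resH1Hom (ContinuousMonoidHom.id (inertiaIn κ.kerSubgroup v)) j (fun _ a ↦ hj' _ a)))
    (hT : Set.Finite {y : Literature.NumberTheory.EllipticCurves.subgroupH1 (κ.kerSubgroup ⊓ decomp 𝔭) A |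
      resH1Hom (ContinuousMonoidHom.id ↥(κ.kerSubgroup ⊓ decomp 𝔭)) j (fun _ a ↦ hj' _ a) y = 0})
    (hA : (datumStrictSelmer κ.kerSubgroup A p (AcSelmer.bdpData A p 𝔭) S₀ :
      Set (Literature.NumberTheory.EllipticCurves.subgroupH1 κ.kerSubgroup A)).Finite) :
    Set.Finite {x : Literature.NumberTheory.EllipticCurves.subgroupH1 κ.kerSubgroup A |
      resH1Hom (ContinuousMonoidHom.id κ.kerSubgroup) j (fun _ a ↦ hj' _ a) x ∈
        datumStrictSelmer κ.kerSubgroup B p (AcSelmer.bdpData B p 𝔭) S₀} := by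
  -- notation
  let H := κ.kerSubgroup
  let jH := resH1Hom (ContinuousMonoidHom.id H) j (fun _ a ↦ hj' _ a)
  let jD := resH1Hom (ContinuousMonoidHom.id ↥(H ⊓ decomp 𝔭)) j (fun _ a ↦ hj' _ a)
  have hconj : ∀ (σ : absoluteGaloisGroup K) (x : Literature.NumberTheory.EllipticCurves.subgroupH1 H A),
      conjH1 H B σ (jH x) = jH (conjH1 H A σ x) := fun σ x ↦
    congrArg (fun f : Literature.NumberTheory.EllipticCurves.subgroupH1 H A →+
        Literature.NumberTheory.EllipticCurves.subgroupH1 H B ↦ f x)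
      (conjH1_comp_resH1Hom_id H j (fun _ a ↦ hj' _ a) hj' σ)
  let resp : Literature.NumberTheory.EllipticCurves.subgroupH1 H A →+
      Literature.NumberTheory.EllipticCurves.subgroupH1 (H ⊓ decomp 𝔭) A :=
    resOfLe A (inf_le_left : H ⊓ decomp 𝔭 ≤ H)
  have hres : ∀ x : Literature.NumberTheory.EllipticCurves.subgroupH1 H A,
      resOfLe B (inf_le_left : H ⊓ decomp 𝔭 ≤ H) (jH x) = jD (resp x) := fun x ↦ by
    have e := congrArg (fun f : Literature.NumberTheory.EllipticCurves.subgroupH1 H A →+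
        Literature.NumberTheory.EllipticCurves.subgroupH1 (H ⊓ decomp 𝔭) B ↦ f x)
      (resOfLe_comp_resH1Hom_id (inf_le_left : H ⊓ decomp 𝔭 ≤ H) j (fun _ a ↦ hj' _ a)
        (fun _ a ↦ hj' _ a))
    simpa only [AddMonoidHom.comp_apply] using e
  -- representatives at `𝔭`
  obtain ⟨c, hc⟩ := forall_resOfLe_conjH1_eq_zero_of_reps (M := A) (κ := κ) 𝔭 h𝔭dec
  have hτex : ∀ i : ℕ, ∃ τ : absoluteGaloisGroup K, κ τ = Multiplicative.ofAdd ((i : ℕ) : ℤ_[p]) :=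
    fun i ↦ κ.surjective _
  choose τ hτ using hτex
  -- the signature map
  let Ψ : Literature.NumberTheory.EllipticCurves.subgroupH1 H A →+
      (Fin (p ^ c) → Literature.NumberTheory.EllipticCurves.subgroupH1 (H ⊓ decomp 𝔭) A) :=
    { toFun := fun x i ↦ resp (conjH1 H A (τ i) x)
      map_zero' := by ext i; simp
      map_add' := fun x y ↦ by ext i; simp }
  -- `Y = j_*⁻¹ R(B)`
  let Y : AddSubgroup (Literature.NumberTheory.EllipticCurves.subgroupH1 H A) :=
    (datumStrictSelmer H B p (AcSelmer.bdpData B p 𝔭) S₀).comap jH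
  have hYmem : ∀ x, x ∈ Y ↔ jH x ∈ datumStrictSelmer H B p (AcSelmer.bdpData B p 𝔭) S₀ := fun x ↦ Iff.rfl
  -- (a) on `Y`, `Ψ` takes values in the finite kernel `T`
  have hΨker : ∀ x ∈ Y, ∀ i : Fin (p ^ c), jD (Ψ x i) = 0 := by
    intro x hx i
    change jD (resp (conjH1 H A (τ i) x)) = 0
    rw [← hres, ← hconj]
    have h := ((mem_datumStrictSelmer_iff _).mp ((hYmem x).mp hx)).2 𝔭 h𝔭 (τ i)
    rw [AcSelmer.bdpData_self p 𝔭 h𝔭, mem_strictKer_strictDatum_iff] at h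
    exact h
  -- (b) the kernel of `Ψ` on `Y` lies in `R(A)`
  have hΨzero : ∀ x ∈ Y, Ψ x = 0 → x ∈ datumStrictSelmer H A p (AcSelmer.bdpData A p 𝔭) S₀ := by
    intro x hx hΨ
    have hxB := (mem_datumStrictSelmer_iff _).mp ((hYmem x).mp hx)
    rw [mem_unramifiedOutside_iff] at hxB
    rw [mem_datumStrictSelmer_iff, mem_unramifiedOutside_iff]
    refine ⟨fun v hvS hvp σ ↦ ?_, fun v hv σ ↦ ?_⟩
    · -- unramified at the good `v ∉ Σ`: (U)
      have h := hxB.1 v hvS hvp σ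
      rw [hconj, GreenbergVatsal2000.unramifiedKer, AddMonoidHom.mem_ker] at h
      rw [GreenbergVatsal2000.unramifiedKer, AddMonoidHom.mem_ker]
      have e := congrArg (fun f : Literature.NumberTheory.EllipticCurves.subgroupH1 H A →+
          discreteH1 (inertiaIn H v) B ↦ f (conjH1 H A σ x))
        (res_inertiaIn_comp_resH1Hom_id H v j (fun _ a ↦ hj' _ a) (fun _ a ↦ hj' _ a))
      simp only [AddMonoidHom.comp_apply] at e
      rw [e] at h
      exact (injective_iff_map_eq_zero _).mp (hU v hvS hvp) _ h
    · by_cases hv𝔭 : v = 𝔭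
      · -- at `𝔭`: all conjugates from the representatives
        subst hv𝔭
        rw [AcSelmer.bdpData_self p v hv, mem_strictKer_strictDatum_iff]
        refine hc τ hτ x (fun i hi ↦ ?_) σ
        exact congrFun hΨ ⟨i, hi⟩
      · rw [AcSelmer.bdpData_of_ne p 𝔭 hv hv𝔭, AcSelmer.strictKer_relaxedDatum_eq_top]
        exact AddSubgroup.mem_top _
  -- (c) `Y` is finite: `Ψ|_Y` has finite kernel and finite target set `T^{p^c}`
  let g : Y →+ (Fin (p ^ c) → Literature.NumberTheory.EllipticCurves.subgroupH1 (H ⊓ decomp 𝔭) A) :=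
    Ψ.comp Y.subtype
  have hgker : ((g.ker : AddSubgroup Y) : Set Y).Finite := by
    have hsub : ((g.ker : AddSubgroup Y) : Set Y) ⊆
        (fun r : Y ↦ (r : Literature.NumberTheory.EllipticCurves.subgroupH1 H A)) ⁻¹'
          (datumStrictSelmer H A p (AcSelmer.bdpData A p 𝔭) S₀ :
            Set (Literature.NumberTheory.EllipticCurves.subgroupH1 H A)) := by
      intro r hr
      exact hΨzero r r.2 ((AddMonoidHom.mem_ker).mp hr)
    exact (hA.preimage Subtype.val_injective.injOn).subset hsub
  let T : Set (Fin (p ^ c) → Literature.NumberTheory.EllipticCurves.subgroupH1 (H ⊓ decomp 𝔭) A) :=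
    Set.pi Set.univ fun _ ↦
      {y : Literature.NumberTheory.EllipticCurves.subgroupH1 (H ⊓ decomp 𝔭) A | jD y = 0}
  have hTfin : T.Finite := Set.Finite.pi fun _ ↦ hT
  have huniv : (g ⁻¹' T) = Set.univ := by
    ext r
    simp only [Set.mem_preimage, Set.mem_univ, iff_true, T, Set.mem_univ_pi, Set.mem_setOf_eq]
    intro i
    exact hΨker r r.2 i
  have hYuniv : (Set.univ : Set Y).Finite := by
    rw [← huniv]
    exact AddMonoidHom.finite_preimage_of_finite_ker g hgker hTfin
  have hY : (Y : Set (Literature.NumberTheory.EllipticCurves.subgroupH1 H A)) =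
      (fun r : Y ↦ (r : Literature.NumberTheory.EllipticCurves.subgroupH1 H A)) '' Set.univ := by
    ext x
    simp only [SetLike.mem_coe, Set.image_univ, Set.mem_range, Subtype.exists, exists_prop,
      exists_eq_right]
  have hYfin : (Y : Set (Literature.NumberTheory.EllipticCurves.subgroupH1 H A)).Finite := by
    rw [hY]; exact hYuniv.image _
  exact hYfin

/-- **Dévissage WITHOUT (S): `R_𝔭^Σ(K_∞, A)` and `R_𝔭^Σ(K_∞, C)` finite ⟹ `R_𝔭^Σ(K_∞, B)` finite**, for a
`Γ_K`-equivariant exact `0 → A —j→ B —q→ C → 0` of discrete `Γ_K`-modules with `C` FINITE (continuous orbit maps on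
`B`), `H = ker κ`, `𝔭 ∋ p` finitely decomposed in `K_∞` (`D_𝔭 ⊄ ker κ`), and (U) at the good places outside `Σ`. The
kernel of `j_*` on `H¹(H ⊓ D_𝔭, ·)` is finite by §1; then `finite_preimage_datumStrictSelmer_of_finite_ker` and the
middle exactness `finite_of_finite_image_of_finite_lifts`. This is CGLS 2022 Prop. 17 (finiteness half) with the
hypothesis `ψ|_{G_p} ≠ 1` REMOVED — the anomalous case of Keller–Yin Thm. 1.4.1.
[cite: CastellaGrossiLeeSkinner2022, Prop. 17 (arXiv:2008.02571 §1.4)]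
[cite: KellerYin2024, Thm. 1.4.1 (arXiv:2402.12781v2 §1.4; anomalous characters allowed)]
[cite: SerreGaloisCohomology1997, I.§2.2] -/
theorem finite_datumStrictSelmer_of_devissage_of_finite [Finite C]
    (h𝔭 : ((p : ℕ) : 𝓞 K) ∈ 𝔭.asIdeal) (h𝔭dec : ¬ (decomp 𝔭 ≤ κ.kerSubgroup)) (j : A →+ B)
    (hj' : ∀ (σ : absoluteGaloisGroup K) (a : A), j (σ • a) = σ • j a) (hinj : Function.Injective j)
    (q : B →+ C) (hq' : ∀ (σ : absoluteGaloisGroup K) (b : B), q (σ • b) = σ • q b)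
    (hsurj : Function.Surjective q) (hexact : ∀ b : B, q b = 0 → ∃ a : A, j a = b)
    (hcontB : ∀ b : B, Continuous fun g : absoluteGaloisGroup K ↦ g • b)
    (hU : ∀ v : HeightOneSpectrum (𝓞 K), v ∉ S₀ → ((p : ℕ) : 𝓞 K) ∉ v.asIdeal →
      Function.Injective
        (resH1Hom (ContinuousMonoidHom.id (inertiaIn κ.kerSubgroup v)) j (fun _ a ↦ hj' _ a)))
    (hA : (datumStrictSelmer κ.kerSubgroup A p (AcSelmer.bdpData A p 𝔭) S₀ :
      Set (Literature.NumberTheory.EllipticCurves.subgroupH1 κ.kerSubgroup A)).Finite)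
    (hC : (datumStrictSelmer κ.kerSubgroup C p (AcSelmer.bdpData C p 𝔭) S₀ :
      Set (Literature.NumberTheory.EllipticCurves.subgroupH1 κ.kerSubgroup C)).Finite) :
    (datumStrictSelmer κ.kerSubgroup B p (AcSelmer.bdpData B p 𝔭) S₀ :
      Set (Literature.NumberTheory.EllipticCurves.subgroupH1 κ.kerSubgroup B)).Finite := by
  have hcontH : ∀ b : B, Continuous fun g : κ.kerSubgroup ↦ g • b := fun b ↦
    (hcontB b).comp continuous_subtype_val
  refine finite_of_finite_image_of_finite_lifts (G := κ.kerSubgroup) j (fun _ a ↦ hj' _ a) hinj q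
    (fun _ b ↦ hq' _ b) hsurj hexact hcontH
    (datumStrictSelmer κ.kerSubgroup B p (AcSelmer.bdpData B p 𝔭) S₀) ?_ ?_
  · -- the image in `H¹(H, C)` lies in `R(C)`
    refine hC.subset ?_
    rintro _ ⟨c, hc, rfl⟩
    exact resH1Hom_id_mem_residualSelmer κ.kerSubgroup p 𝔭 S₀ q hq' (fun _ b ↦ hq' _ b) hc
  · -- the preimage in `H¹(H, A)` is finite: §1 + the signature argument
    refine finite_preimage_datumStrictSelmer_of_finite_ker κ 𝔭 S₀ h𝔭 h𝔭dec j hj' hU ?_ hA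
    exact finite_ker_resH1Hom_id_of_finite (G := ↥(κ.kerSubgroup ⊓ decomp 𝔭)) j (fun _ a ↦ hj' _ a) hinj q
      hexact

/-- **The same with (U) discharged**: «`I_v` acts trivially on `B` at every `v ∉ Σ`, `v ∤ p`» (unramified
coefficients, e.g. `B = E[p]`, `Σ ⊇` the bad places prime to `p`). No hypothesis at `𝔭` on `C`.
[cite: CastellaGrossiLeeSkinner2022, Prop. 17 (arXiv:2008.02571 §1.4)] [cite: SerreGaloisCohomology1997, I.§2.3] -/
theorem finite_datumStrictSelmer_of_devissage_of_finite_of_unramified [Finite C]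
    (h𝔭 : ((p : ℕ) : 𝓞 K) ∈ 𝔭.asIdeal) (h𝔭dec : ¬ (decomp 𝔭 ≤ κ.kerSubgroup)) (j : A →+ B)
    (hj' : ∀ (σ : absoluteGaloisGroup K) (a : A), j (σ • a) = σ • j a) (hinj : Function.Injective j)
    (q : B →+ C) (hq' : ∀ (σ : absoluteGaloisGroup K) (b : B), q (σ • b) = σ • q b)
    (hsurj : Function.Surjective q) (hexact : ∀ b : B, q b = 0 → ∃ a : A, j a = b)
    (hcontB : ∀ b : B, Continuous fun g : absoluteGaloisGroup K ↦ g • b)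
    (hunr : ∀ v : HeightOneSpectrum (𝓞 K), v ∉ S₀ → ((p : ℕ) : 𝓞 K) ∉ v.asIdeal →
      ∀ (τ : inertiaIn κ.kerSubgroup v) (b : B), τ • b = b)
    (hA : (datumStrictSelmer κ.kerSubgroup A p (AcSelmer.bdpData A p 𝔭) S₀ :
      Set (Literature.NumberTheory.EllipticCurves.subgroupH1 κ.kerSubgroup A)).Finite)
    (hC : (datumStrictSelmer κ.kerSubgroup C p (AcSelmer.bdpData C p 𝔭) S₀ :
      Set (Literature.NumberTheory.EllipticCurves.subgroupH1 κ.kerSubgroup C)).Finite) :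
    (datumStrictSelmer κ.kerSubgroup B p (AcSelmer.bdpData B p 𝔭) S₀ :
      Set (Literature.NumberTheory.EllipticCurves.subgroupH1 κ.kerSubgroup B)).Finite := by
  refine finite_datumStrictSelmer_of_devissage_of_finite κ 𝔭 S₀ h𝔭 h𝔭dec j hj' hinj q hq' hsurj hexact
    hcontB ?_ hA hC
  intro v hvS hvp
  exact resH1Hom_id_injective_of_smul_eq (G := ↥(inertiaIn κ.kerSubgroup v)) j (fun _ a ↦ hj' _ a) hinj
    (hunr v hvS hvp)

end Residual

/-! ### §3 The elliptic-curve assembly without the fixed-vector hypothesis -/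

section Curve

variable {K : Type} [Field K] [NumberField K] (W : WeierstrassCurve K) [W.IsElliptic] {p : ℕ}
  [Fact p.Prime] (κ : ZpExtension K p)

/-- **`Sel_𝔭^Σ(K_∞, E[p^∞])[p]` finite from the residual dévissage along a stable line, WITHOUT the
non-anomalous clause.** For an elliptic curve `E = W/K` over a number field, ANY `ℤ_p`-extension `κ`, a place
`𝔭 ∋ p` finitely decomposed in `K_∞` (`D_𝔭 ⊄ ker κ`), a set `Σ` containing every bad place prime to `p`, and ANY
`Γ_K`-stable subgroup `Φ ≤ E[p]`: if Castella's residual Selmer groups `R_𝔭^Σ(K_∞, Φ)` and `R_𝔭^Σ(K_∞, E[p]/Φ)`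
are finite then `{s ∈ Sel_𝔭^Σ(K_∞, E[p^∞]) | p s = 0}` is finite — the tree's
`…ResidualDevissage.finite_selmerAc_pTorsion_of_line_devissage` (chl-k1) with its hypothesis
«`(E[p]/Φ)^{G_{K_{∞,𝔭}}} = 0`» REMOVED (§2: `E[p]/Φ` is finite; (U) by Néron–Ogg–Shafarevich at the good
places; then CGLS Prop. 18 / Lim–Sujatha, tree `finite_selmerAc_pTorsion_of_finite_residualSelmer`). At a SPLIT
multiplicative Eisenstein prime this is the shape needed for BOTH local types of the rational line.
[cite: CastellaGrossiLeeSkinner2022, §1.4 Props. 17–18 (arXiv:2008.02571)] [cite: LimSujatha2018, §3 Prop. 3.2]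
[cite: KellerYin2024, Thm. 1.4.1 and Lemma 5.1.1 (arXiv:2402.12781v2)] [cite: SilvermanAEC2009, Prop. VII.4.1(a)] -/
theorem finite_selmerAc_pTorsion_of_line_devissage_of_finite
    {𝔭 : HeightOneSpectrum (𝓞 K)} (h𝔭 : ((p : ℕ) : 𝓞 K) ∈ 𝔭.asIdeal)
    (h𝔭dec : ¬ (decomp 𝔭 ≤ κ.kerSubgroup)) {S : Set (HeightOneSpectrum (𝓞 K))}
    (hS : ∀ v : HeightOneSpectrum (𝓞 K), v ∉ S → ((p : ℕ) : 𝓞 K) ∉ v.asIdeal → W.HasGoodReductionAt v)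
    (Φ : StableSubgroup (absoluteGaloisGroup K) (W.geomTorsion (p : ℤ)))
    (hΦ : (datumStrictSelmer κ.kerSubgroup Φ.Sub p (AcSelmer.bdpData Φ.Sub p 𝔭) S :
      Set (Literature.NumberTheory.EllipticCurves.subgroupH1 κ.kerSubgroup Φ.Sub)).Finite)
    (hΨ : (datumStrictSelmer κ.kerSubgroup Φ.Quot p (AcSelmer.bdpData Φ.Quot p 𝔭) S :
      Set (Literature.NumberTheory.EllipticCurves.subgroupH1 κ.kerSubgroup Φ.Quot)).Finite) :
    Set.Finite {s : selmerAc W p κ 𝔭 S | p • s = 0} := by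
  have hpp : p.Prime := Fact.out
  -- `E[p]/Φ` is finite
  have hEp : Nat.card (W.geomTorsion ((p : ℕ) : ℤ)) = p ^ 2 := W.natCard_geomTorsion_prime_eq_sq hpp
  haveI : Finite Φ.Quot := by
    refine Nat.finite_of_card_ne_zero fun h0 ↦ ?_
    have h := Φ.natCard_eq_mul
    rw [hEp, h0] at h
    exact pow_ne_zero 2 hpp.ne_zero (by simpa using h)
  have hcont : ∀ b : W.geomTorsion (p : ℤ), Continuous fun g : absoluteGaloisGroup K ↦ g • b :=
    continuous_smul_geomTorsion W (p : ℤ)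
  have hR : (datumStrictSelmer κ.kerSubgroup (W.geomTorsion (p : ℤ)) p (AcSelmer.bdpData _ p 𝔭) S :
      Set (Literature.NumberTheory.EllipticCurves.subgroupH1 κ.kerSubgroup (W.geomTorsion (p : ℤ)))).Finite :=
    finite_datumStrictSelmer_of_devissage_of_finite_of_unramified κ 𝔭 S h𝔭 h𝔭dec Φ.incl Φ.incl_smul
      Φ.incl_injective Φ.proj Φ.proj_smul Φ.proj_surjective
      (fun b hb ↦ AddMonoidHom.mem_range.mp (Φ.mem_range_incl_of_proj_eq_zero b hb)) hcont
      (fun v hvS hvp τ b ↦ CumulativeHeegnerInclusionAtThreeStubB1DevissageCurve.inertiaIn_smul_geomTorsion_eq W p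
        κ.kerSubgroup (hS v hvS hvp) hvp τ b) hΦ hΨ
  exact finite_selmerAc_pTorsion_of_finite_residualSelmer W κ h𝔭 h𝔭dec hS hR

end Curve



end Summit.BirchSwinnertonDyer.BirchSwinnertonDyer.Theorems.ResidualDevissageFiniteKernel

end
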